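import Mathlib.Topology.Sequences
import Mathlib.Topology.Bases
import Mathlib.Topology.MetricSpace.ProperSpace
import Literature.Analysis.FunctionSpaces.PointConfigVagueTopology

/-!
# Tangent tightness, compactness I: vague limits of separated configurations (line `FirstLemma`, crux stmt-AtomisticToContinuum-14135)

Helper file of the registered stub `stub_hardCoreLawsVaguelyCompact` (Kallenberg 2002, Lemma 16.15 +
Thm. 16.16 + Thm. A2.3 (ii), specialised to hard-core laws), namespace
`Summit.AtomisticToContinuum.HydrodynamicLimit.Theorems.KiferCompactification`.

* `stub_vagueSeqCompactOfSeparated` (REGISTERED stub of this helper file): **sequential compactness of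
  uniformly separated configurations in the vague topology.** In a proper metric space `X`, every sequence
  `ω_k` of `δ`-separated (`δ > 0`) locally finite configurations has a subsequence converging vaguely
  (`PointConfig.instTopologicalSpace`: `∑_{p ∈ ω_k} f p → ∑_{p ∈ ν} f p` for all `f ∈ C_c(X, ℝ)`) to a
  `δ`-separated configuration `ν`, every point of which is approached by points of the subsequence
  (Kallenberg 2002 Thm. A2.3 (ii) for simple point measures with a hard core; Baake–Lenz 2004 in the local
  rubber topology).

Proof: probe extraction along a dense sequence (compactness of `ℕ × ℚ → Bool`, as in
`Literature/MathematicalPhysics/StatisticalMechanics/LocalMatchingCompactness.lean`, here for a general proper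
metric space), the limit being the Kuratowski lower limit; vague convergence because, on the support of a
test function, eventually every particle sits alone in the `δ/2`-ball of a limit point and converges to it.

No new definitions. References: O. Kallenberg, *Foundations of Modern Probability* (2002), Thm. A2.3,
Lemma 16.15; M. Baake, D. Lenz, Ergodic Theory Dynam. Systems 24 (2004) §3.
-/

noncomputable section

open Set Filter Topology Function Metric

namespace Summit.AtomisticToContinuum.HydrodynamicLimit.Theorems.KiferCompactification

open Literature.Analysis.FunctionSpaces (PointConfig)

variable {X : Type*} [MetricSpace X]

/-! ## Separated sets -/

/-- A `δ`-separated (`δ > 0`) subset of a compact set is finite (an infinite one would have an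
accumulation point, near which two distinct points would be closer than `δ`). -/
theorem finite_of_separated_of_subset_isCompact {S K : Set X} {δ : ℝ} (hδ : 0 < δ)
    (hsep : ∀ p ∈ S, ∀ q ∈ S, p ≠ q → δ ≤ dist p q) (hK : IsCompact K) (hS : S ⊆ K) :
    S.Finite := by
  by_contra hinf
  obtain ⟨a, -, ha⟩ := Set.Infinite.exists_accPt_of_subset_isCompact hinf hK hS
  rw [accPt_iff_nhds] at ha
  obtain ⟨y₁, ⟨hy₁U, hy₁S⟩, hy₁a⟩ := ha (ball a (δ / 2)) (ball_mem_nhds a (half_pos hδ))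
  have hr : 0 < dist y₁ a := dist_pos.2 hy₁a
  obtain ⟨y₂, ⟨hy₂U, hy₂S⟩, -⟩ := ha (ball a (dist y₁ a)) (ball_mem_nhds a hr)
  rw [mem_ball] at hy₁U hy₂U
  have hne : y₁ ≠ y₂ := fun h => by
    rw [h] at hy₂U
    exact lt_irrefl _ hy₂U
  have h1 := hsep y₁ hy₁S y₂ hy₂S hne
  have : dist y₁ y₂ < δ :=
    calc dist y₁ y₂ ≤ dist y₁ a + dist y₂ a := dist_triangle_right _ _ _
      _ < δ / 2 + δ / 2 := add_lt_add hy₁U (hy₂U.trans hy₁U)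
      _ = δ := by ring
  linarith

/-- The Kuratowski lower limit of a sequence of `δ`-separated sets is `δ`-separated. -/
theorem le_dist_of_eventually_approached {W : ℕ → Set X} {δ : ℝ}
    (hsep : ∀ k, ∀ p ∈ W k, ∀ q ∈ W k, p ≠ q → δ ≤ dist p q) {p q : X}
    (hp : ∀ ε : ℝ, 0 < ε → ∀ᶠ k in atTop, ∃ a ∈ W k, dist a p < ε)
    (hq : ∀ ε : ℝ, 0 < ε → ∀ᶠ k in atTop, ∃ a ∈ W k, dist a q < ε) (hpq : p ≠ q) :
    δ ≤ dist p q := by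
  have hpq0 : 0 < dist p q := dist_pos.2 hpq
  refine le_of_forall_pos_lt_add fun η hη => ?_
  set ε : ℝ := min (η / 4) (dist p q / 4) with hε
  have hε0 : 0 < ε := lt_min (by linarith) (by linarith)
  have hεη : ε ≤ η / 4 := min_le_left _ _
  have hεpq : ε ≤ dist p q / 4 := min_le_right _ _
  obtain ⟨k, ⟨a, ha, hap⟩, ⟨b, hb, hbq⟩⟩ := ((hp ε hε0).and (hq ε hε0)).exists
  by_cases hab : a = b
  · subst hab
    have : dist p q < 2 * ε :=
      calc dist p q ≤ dist a p + dist a q := dist_triangle_left _ _ _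
        _ < ε + ε := add_lt_add hap hbq
        _ = 2 * ε := by ring
    linarith
  · have h1 := hsep k a ha b hb hab
    have : dist a b < dist p q + 2 * ε :=
      calc dist a b ≤ dist a p + dist p b := dist_triangle _ _ _
        _ ≤ dist a p + (dist p q + dist b q) := add_le_add le_rfl (dist_triangle_right _ _ _)
        _ < ε + (dist p q + ε) := add_lt_add_of_lt_of_le hap (add_le_add le_rfl hbq.le)
        _ = dist p q + 2 * ε := by ring
    linarith

/-! ## Probe extraction -/

/-- **Probe extraction.** For every sequence of subsets of a proper metric space there is a subsequence
along which approach is stable: a point approached within every `ε` infinitely often is approached within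
every `ε` eventually. (Record for each probe ball `B(u n, r)`, `u` a dense sequence, `r ∈ ℚ`, whether the
set meets it, and extract a subsequence along which every probe is eventually constant, by compactness and
first countability of `ℕ × ℚ → Bool`.) -/
theorem exists_subseq_eventually_approached_of_frequently [ProperSpace X] [Nonempty X]
    (W : ℕ → Set X) :
    ∃ φ : ℕ → ℕ, StrictMono φ ∧ ∀ p : X,
      (∀ ε : ℝ, 0 < ε → ∃ᶠ k in atTop, ∃ q ∈ W (φ k), dist q p < ε) →
        ∀ ε : ℝ, 0 < ε → ∀ᶠ k in atTop, ∃ q ∈ W (φ k), dist q p < ε := by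
  classical
  obtain ⟨u, hu⟩ := TopologicalSpace.exists_dense_seq X
  let probe : ℕ → (ℕ × ℚ → Bool) := fun k nr =>
    decide (∃ q ∈ W k, dist q (u nr.1) < ((nr.2 : ℚ) : ℝ))
  obtain ⟨L, φ, hφ, hL⟩ := CompactSpace.tendsto_subseq probe
  have hKey0 : ∀ (n : ℕ) (r : ℚ), (∃ᶠ k in atTop, ∃ q ∈ W (φ k), dist q (u n) < (r : ℝ)) →
      ∀ᶠ k in atTop, ∃ q ∈ W (φ k), dist q (u n) < (r : ℝ) := by
    intro n r hfr
    have ht : Tendsto (fun k => probe (φ k) (n, r)) atTop (𝓝 (L (n, r))) :=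
      tendsto_pi_nhds.1 hL (n, r)
    rw [nhds_discrete Bool, tendsto_pure] at ht
    cases hLnr : L (n, r) with
    | true =>
      filter_upwards [ht] with k hk
      rw [hLnr] at hk
      simpa [probe] using hk
    | false =>
      exfalso
      obtain ⟨k, hk1, hk2⟩ := (hfr.and_eventually ht).exists
      rw [hLnr] at hk2
      simp only [probe, decide_eq_false_iff_not] at hk2
      exact hk2 hk1
  refine ⟨φ, hφ, fun p hp ε hε => ?_⟩
  obtain ⟨r, hr0, hrε⟩ := exists_rat_btwn (half_pos hε)
  have hr0' : (0 : ℝ) < r := by exact_mod_cast hr0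
  obtain ⟨n, hn⟩ := hu.exists_dist_lt p (half_pos hr0')
  have hfr : ∃ᶠ k in atTop, ∃ q ∈ W (φ k), dist q (u n) < (r : ℝ) := by
    refine (hp (r / 2) (half_pos hr0')).mono fun k ⟨q, hq, hqp⟩ => ⟨q, hq, ?_⟩
    calc dist q (u n) ≤ dist q p + dist p (u n) := dist_triangle _ _ _
      _ < r / 2 + r / 2 := add_lt_add hqp hn
      _ = r := by ring
  filter_upwards [hKey0 n r hfr] with k ⟨q, hq, hqn⟩
  refine ⟨q, hq, ?_⟩
  calc dist q p ≤ dist q (u n) + dist p (u n) := dist_triangle_right _ _ _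
    _ < r + r / 2 := add_lt_add hqn hn
    _ < ε := by linarith

/-! ## Sequential compactness of separated configurations in the vague topology -/

/-- **Sequential vague compactness of uniformly separated configurations** (Kallenberg 2002, Thm. A2.3 (ii)
for simple point measures with a hard core). Let `X` be a proper metric space, `δ > 0`, and `ω_k` locally
finite configurations each of which is `δ`-separated. Then along some subsequence `φ`, `ω_(φ k)` converges in
the vague topology of `PointConfig X` to a `δ`-separated configuration `ν`, and every point of `ν` is, for
every `ε > 0`, eventually within `ε` of a point of `ω_(φ k)`. Registered helper stub of line `FirstLemma`. -/
theorem stub_vagueSeqCompactOfSeparated {X : Type*} [MetricSpace X] [ProperSpace X] {δ : ℝ}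
    (hδ : 0 < δ) (ω : ℕ → PointConfig X)
    (hsep : ∀ k, ∀ p ∈ ω k, ∀ q ∈ ω k, p ≠ q → δ ≤ dist p q) :
    ∃ (φ : ℕ → ℕ) (ν : PointConfig X), StrictMono φ ∧
      (∀ p ∈ ν, ∀ q ∈ ν, p ≠ q → δ ≤ dist p q) ∧
      (∀ p ∈ ν, ∀ ε : ℝ, 0 < ε → ∀ᶠ k in atTop, ∃ q ∈ ω (φ k), dist q p < ε) ∧
      Tendsto (fun k => ω (φ k)) atTop (𝓝 ν) := by
  classical
  rcases isEmpty_or_nonempty X with hX | hX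
  · have hall : ∀ k, ω k = ∅ := fun k => PointConfig.ext fun p => isEmptyElim p
    refine ⟨id, ∅, strictMono_id, fun p => isEmptyElim p, fun p => isEmptyElim p, ?_⟩
    simp only [hall, id]
    exact tendsto_const_nhds
  obtain ⟨φ, hφ, hKey⟩ := exists_subseq_eventually_approached_of_frequently (fun k => (ω k : Set X))
  -- the subsequence and its Kuratowski lower limit
  set W : ℕ → Set X := fun k => (ω (φ k) : Set X) with hW
  have hsepW : ∀ k, ∀ p ∈ W k, ∀ q ∈ W k, p ≠ q → δ ≤ dist p q := fun k => hsep (φ k)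
  set L : Set X := {p | ∀ ε : ℝ, 0 < ε → ∀ᶠ k in atTop, ∃ a ∈ W k, dist a p < ε} with hL
  have hLsep : ∀ p ∈ L, ∀ q ∈ L, p ≠ q → δ ≤ dist p q :=
    fun p hp q hq hpq => le_dist_of_eventually_approached hsepW hp hq hpq
  have hLfin : ∀ K : Set X, IsCompact K → (L ∩ K).Finite := fun K hK =>
    finite_of_separated_of_subset_isCompact hδ (fun p hp q hq hpq => hLsep p hp.1 q hq.1 hpq) hK
      inter_subset_right
  let ν : PointConfig X := ⟨L, hLfin⟩
  have hνL : (ν : Set X) = L := rfl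
  -- (A) a limit point is eventually matched by exactly one particle in its `δ/2`-ball, converging to it
  set q : X → ℕ → X := fun x k =>
    if h : (W k ∩ ball x (δ / 2)).Nonempty then h.some else x with hq
  have hA : ∀ x ∈ L, (∀ᶠ k in atTop, W k ∩ ball x (δ / 2) = {q x k}) ∧
      Tendsto (q x) atTop (𝓝 x) := by
    intro x hx
    have huniq : ∀ k, (W k ∩ ball x (δ / 2)).Nonempty → W k ∩ ball x (δ / 2) = {q x k} := by
      intro k hk
      have hqk : q x k = hk.some := by rw [hq]; exact dif_pos hk
      have hmem : q x k ∈ W k ∩ ball x (δ / 2) := hqk ▸ hk.some_mem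
      refine Set.eq_singleton_iff_unique_mem.2 ⟨hmem, fun a ha => ?_⟩
      by_contra hne
      have h1 := hsepW k a ha.1 (q x k) hmem.1 hne
      have h2 : dist a (q x k) < δ :=
        calc dist a (q x k) ≤ dist a x + dist (q x k) x := dist_triangle_right _ _ _
          _ < δ / 2 + δ / 2 := add_lt_add (mem_ball.1 ha.2) (mem_ball.1 hmem.2)
          _ = δ := by ring
      linarith
    refine ⟨?_, ?_⟩
    · filter_upwards [hx (δ / 2) (half_pos hδ)] with k ⟨a, ha, hax⟩
      exact huniq k ⟨a, ha, mem_ball.2 hax⟩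
    · rw [Metric.tendsto_atTop']
      intro ε hε
      have hε' : 0 < min ε (δ / 2) := lt_min hε (half_pos hδ)
      obtain ⟨N, hN⟩ := eventually_atTop.1 (hx _ hε')
      refine ⟨N, fun k hk => ?_⟩
      obtain ⟨a, ha, hax⟩ := hN k hk.le
      have hax' : a ∈ W k ∩ ball x (δ / 2) := ⟨ha, mem_ball.2 (hax.trans_le (min_le_right _ _))⟩
      have heq := huniq k ⟨a, hax'⟩
      rw [heq, mem_singleton_iff] at hax'
      rw [← hax']
      exact hax.trans_le (min_le_left _ _)
  refine ⟨φ, ν, hφ, hLsep, fun p hp => hp, ?_⟩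
  rw [PointConfig.tendsto_nhds_iff]
  intro f
  set K : Set X := tsupport (f : X → ℝ) with hKdef
  have hK : IsCompact K := f.hasCompactSupport
  have hFfin : (L ∩ K).Finite := hLfin K hK
  -- (B) eventually, every particle in the support sits in the `δ/2`-ball of a limit point of `K`
  have hB : ∀ᶠ k in atTop, W k ∩ K ⊆ ⋃ x ∈ L ∩ K, ball x (δ / 2) := by
    by_contra hcon
    obtain ⟨ψ, hψ, hψP⟩ := extraction_of_frequently_atTop (not_eventually.1 hcon)
    have hex : ∀ l, ∃ a, a ∈ W (ψ l) ∩ K ∧ a ∉ ⋃ x ∈ L ∩ K, ball x (δ / 2) := fun l =>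
      not_subset.1 (hψP l)
    choose a haWK hfar using hex
    obtain ⟨b, hbK, θ, hθ, hlim⟩ := hK.tendsto_subseq (x := a) fun l => (haWK l).2
    have hbL : b ∈ L := by
      refine hKey b fun ε' hε' => ?_
      have hi : ∀ᶠ i in atTop, dist (a (θ i)) b < ε' := Metric.tendsto_nhds.1 hlim ε' hε'
      refine frequently_atTop.2 fun N => ?_
      obtain ⟨i, hi', hiN⟩ := (hi.and (eventually_ge_atTop N)).exists
      exact ⟨ψ (θ i), hiN.trans (hθ.le_apply.trans hψ.le_apply), a (θ i), (haWK (θ i)).1, hi'⟩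
    obtain ⟨i, hi⟩ := (Metric.tendsto_nhds.1 hlim (δ / 2) (half_pos hδ)).exists
    exact hfar (θ i) (mem_biUnion (show b ∈ L ∩ K from ⟨hbL, hbK⟩) (mem_ball.2 hi))
  have hE : ∀ᶠ k in atTop, ∀ x ∈ L ∩ K, W k ∩ ball x (δ / 2) = {q x k} :=
    hFfin.eventually_all.2 fun x hx => (hA x hx.1).1
  -- the limit statistic is a finite sum over `L ∩ K`
  have hν : ν.sumFn f = ∑ x ∈ hFfin.toFinset, f x := by
    rw [PointConfig.sumFn_def, hνL]
    refine finsum_mem_eq_sum_of_subset _ (fun p hp => ?_) ?_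
    · rw [Finite.coe_toFinset]
      exact ⟨hp.1, subset_tsupport _ hp.2⟩
    · rw [Finite.coe_toFinset]
      exact inter_subset_left
  have hlim : Tendsto (fun k => ∑ x ∈ hFfin.toFinset, f (q x k)) atTop
      (𝓝 (∑ x ∈ hFfin.toFinset, f x)) :=
    tendsto_finsetSum _ fun x hx =>
      (f.continuous.tendsto x).comp (hA x (hFfin.mem_toFinset.1 hx).1).2
  rw [hν]
  refine hlim.congr' ?_
  filter_upwards [hB, hE] with k hkB hkE
  -- the `k`-th statistic, split over the disjoint balls
  have hdisj : (L ∩ K).PairwiseDisjoint fun x => W k ∩ ball x (δ / 2) := by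
    intro x hx y hy hxy
    refine disjoint_left.2 fun p hpx hpy => ?_
    have h1 := hLsep x hx.1 y hy.1 hxy
    have h2 : dist x y < δ :=
      calc dist x y ≤ dist p x + dist p y := dist_triangle_left _ _ _
        _ < δ / 2 + δ / 2 := add_lt_add (mem_ball.1 hpx.2) (mem_ball.1 hpy.2)
        _ = δ := by ring
    linarith
  have hsplit : (ω (φ k)).sumFn f = ∑ᶠ p ∈ ⋃ x ∈ L ∩ K, (W k ∩ ball x (δ / 2)), f p := by
    rw [PointConfig.sumFn_def]
    refine finsum_mem_inter_support_eq _ _ _ (Set.ext fun p => ⟨fun hp => ?_, fun hp => ?_⟩)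
    · have hpK : p ∈ K := subset_tsupport _ hp.2
      obtain ⟨x, hx, hpx⟩ := mem_iUnion₂.1 (hkB ⟨hp.1, hpK⟩)
      exact ⟨mem_biUnion hx ⟨hp.1, hpx⟩, hp.2⟩
    · obtain ⟨x, -, hpx⟩ := mem_iUnion₂.1 hp.1
      exact ⟨hpx.1, hp.2⟩
  rw [hsplit, finsum_mem_biUnion hdisj hFfin fun x hx => ?_, finsum_mem_eq_finite_toFinset_sum _ hFfin]
  · refine Finset.sum_congr rfl fun x hx => ?_
    rw [hkE x (hFfin.mem_toFinset.1 hx), finsum_mem_singleton]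
  · rw [hkE x hx]
    exact finite_singleton _

end Summit.AtomisticToContinuum.HydrodynamicLimit.Theorems.KiferCompactification
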